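import Mathlib
import Summits.MatrixMultiplication.MatrixMultiplication.Theses.SnSubsetDichotomy
import Literature.Combinatorics.Additive.TPPGroupAlgebra
import Summits.MatrixMultiplication.MatrixMultiplication.Theorems.SnSubsetDichotomyJuntaBranchStubCash

/-!
# `SnSubsetDichotomy.JuntaBranch` ⇐ ALIGNED-OR-ABSENT (line `Sketch` / card `alignment-trichotomy`, the composition)

Crux `stmt-MatrixMultiplication-8304` (`JuntaBranch`, route `SnSubsetDichotomy`).  The round-2 idea
card `Cruxes/JuntaBranch/Ideas/alignment-trichotomy.md` splits the crux's bump hypothesis by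
ALIGNMENT: a super-neutral umvirate block `(I → L)` of one member of a near-threshold TPP triple is
*aligned* if the two partner sets have source blocks `J, P` at the SAME target `L` whose product with
it gains the factor `e^{c+1}` in normalised volume, and the card's transfer target `C⁺`
("aligned-or-absent") asserts that, eventually, every super-neutral block of a Large TPP triple is
aligned.  This file proves the card's composition, stated there only as a `Prop`
(`SketchIdeator5.juntaBranch_of_alignedOrAbsent`): **`C⁺ → JuntaBranch`**
(`juntaBranch_of_alignedOrAbsent`, registered sub-goal of the crux), with `C⁺` in its first-set
form — sufficient because the outer quantifier ranges over all TPP triples, the triple product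
property is invariant under the cyclic rotation `(S,T,U) ↦ (T,U,S)`
(`TripleProductProperty.rotate`) and the volume is symmetric.

Proof: rotate the bumped set to the front, take the partner sources `J, P` from `C⁺`, and cash the
common-target block with `stub_cash` (file `SnSubsetDichotomyJuntaBranchStubCash`: the route item
`UmvirateDescent` at `n' = n - t ∈ [n - √n, n)`).  No definition, no fact; every `n`.

What this does NOT do: prove `C⁺`.  By the same-target packing caps
(`SnSubsetDichotomyJuntaBranchSameTargetCaps`) no block of level `t` with `ε t log n > 2c√n + c + 1`
can be aligned, so `C⁺` contains a `∀ c` high-level bump-exclusion statement for Large triples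
(a Global-branch-type statement); it is recorded in the crux workfiles as strictly stronger than the
crux and without a known engine (lead c2, `Lines/Sketch.dead.md`).
-/

set_option linter.dupNamespace false

open Literature.Combinatorics.Additive
open Summit.MatrixMultiplication.MatrixMultiplication.Theses.SnSubsetDichotomy
open scoped Classical

namespace Summit.MatrixMultiplication.MatrixMultiplication.Theorems.JuntaBranch

/-- **`JuntaBranch` from ALIGNED-OR-ABSENT** (registered sub-goal `juntaBranch_of_alignedOrAbsent`
of crux stmt-MatrixMultiplication-8304; composition of line `Sketch`, card `alignment-trichotomy`).
If for all `ε, c > 0` and `n ≥ n₀(ε,c)`, in every TPP triple `S, T, U ⊆ S_n` with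
`(n!)^{3/2} e^{-c√n} ≤ |S||T||U|`, every block `(I → L)` of `S` of level `1 ≤ t ≤ √n` with
`n^{(1/2+ε)t}|S| < |S ∩ U_{I→L}|·n^{(t)}` admits injective `J, P` with
`e^{c+1}|S||T||U|((n-t)!/n!)^{3/2} ≤ |S ∩ U_{I→L}|·|T ∩ U_{J→L}|·|U ∩ U_{P→L}|`, then `JuntaBranch`.
Proof: rotate the bumped set to the front (`TripleProductProperty.rotate`), take `J, P`, cash with
`stub_cash`. -/
theorem juntaBranch_of_alignedOrAbsent :
    (∀ ε : ℝ, 0 < ε → ∀ c : ℝ, 0 < c → ∃ n₀ : ℕ, ∀ n ≥ n₀,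
      ∀ S T U : Finset (Equiv.Perm (Fin n)), TripleProductProperty S T U →
      (n.factorial : ℝ) ^ ((3 : ℝ) / 2) * Real.exp (-(c * Real.sqrt (n : ℝ))) ≤
        ((S.card * T.card * U.card : ℕ) : ℝ) →
      ∀ t : ℕ, 1 ≤ t → (t : ℝ) ≤ Real.sqrt (n : ℝ) → ∀ I L : Fin t → Fin n,
        Function.Injective I → Function.Injective L →
        (n : ℝ) ^ ((1 / 2 + ε) * t) * (S.card : ℝ) <
          ((S.filter (fun σ => ∀ k, σ (I k) = L k)).card : ℝ) * (n.descFactorial t : ℝ) →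
        ∃ J P : Fin t → Fin n, Function.Injective J ∧ Function.Injective P ∧
          Real.exp (c + 1) * ((S.card * T.card * U.card : ℕ) : ℝ) *
              ((((n - t).factorial : ℕ) : ℝ) / (n.factorial : ℝ)) ^ ((3 : ℝ) / 2) ≤
            (((S.filter (fun σ => ∀ k, σ (I k) = L k)).card *
                (T.filter (fun σ => ∀ k, σ (J k) = L k)).card *
                (U.filter (fun σ => ∀ k, σ (P k) = L k)).card : ℕ) : ℝ)) →
    JuntaBranch := by
  intro hAligned ε hε c hc
  obtain ⟨n₀, h₀⟩ := hAligned ε hε c hc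
  refine ⟨n₀, ?_⟩
  intro n hn S T U hTPP hLarge hBumpy
  -- the core: a Large TPP triple whose FIRST set is bumpy is improved (alignment + cash)
  have core : ∀ A B C : Finset (Equiv.Perm (Fin n)), TripleProductProperty A B C →
      (n.factorial : ℝ) ^ ((3 : ℝ) / 2) * Real.exp (-(c * Real.sqrt (n : ℝ))) ≤
        ((A.card * B.card * C.card : ℕ) : ℝ) →
      ∀ t : ℕ, 1 ≤ t → (t : ℝ) ≤ Real.sqrt (n : ℝ) → ∀ I L : Fin t → Fin n,
        Function.Injective I → Function.Injective L →
        (n : ℝ) ^ ((1 / 2 + ε) * t) * (A.card : ℝ) <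
          ((A.filter (fun σ => ∀ k, σ (I k) = L k)).card : ℝ) * (n.descFactorial t : ℝ) →
        ∃ n' : ℕ, (n : ℝ) - Real.sqrt (n : ℝ) ≤ (n' : ℝ) ∧ n' < n ∧
          ∃ S' T' U' : Finset (Equiv.Perm (Fin n')), TripleProductProperty S' T' U' ∧
            Real.exp (c + 1) * ((A.card * B.card * C.card : ℕ) : ℝ) *
                ((n'.factorial : ℝ) / (n.factorial : ℝ)) ^ ((3 : ℝ) / 2) ≤
              ((S'.card * T'.card * U'.card : ℕ) : ℝ) := by
    intro A B C hABC hLA t ht1 ht2 I L hI hL hbump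
    obtain ⟨J, P, hJ, hP, hgain⟩ := h₀ n hn A B C hABC hLA t ht1 ht2 I L hI hL hbump
    exact stub_cash n c A B C hABC t ht1 ht2 L I J P hL hI hJ hP hgain
  -- which set carries the bump: rotate it to the front
  obtain ⟨X, hX, t, ht1, ht2, I, L, hI, hL, hbump⟩ := hBumpy
  rcases hX with hXS | hXT | hXU
  · rw [hXS] at hbump
    exact core S T U hTPP hLarge t ht1 ht2 I L hI hL hbump
  · rw [hXT] at hbump
    have hvolT : T.card * U.card * S.card = S.card * T.card * U.card := by ring
    have hL1 : (n.factorial : ℝ) ^ ((3 : ℝ) / 2) * Real.exp (-(c * Real.sqrt (n : ℝ))) ≤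
        ((T.card * U.card * S.card : ℕ) : ℝ) := by rw [hvolT]; exact hLarge
    have h := core T U S hTPP.rotate hL1 t ht1 ht2 I L hI hL hbump
    rw [hvolT] at h
    exact h
  · rw [hXU] at hbump
    have hvolU : U.card * S.card * T.card = S.card * T.card * U.card := by ring
    have hL1 : (n.factorial : ℝ) ^ ((3 : ℝ) / 2) * Real.exp (-(c * Real.sqrt (n : ℝ))) ≤
        ((U.card * S.card * T.card : ℕ) : ℝ) := by rw [hvolU]; exact hLarge
    have h := core U S T hTPP.rotate.rotate hL1 t ht1 ht2 I L hI hL hbump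
    rw [hvolU] at h
    exact h

end Summit.MatrixMultiplication.MatrixMultiplication.Theorems.JuntaBranch
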